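import Summits.QuantumAdvantage.QuantumAdvantage.Theses.CubicForrelation
import Summits.QuantumAdvantage.QuantumAdvantage.Theorems.NearExactIsExact.Negative.ConcatDefect

/-!
# Crux `CubicForrelation.NearExactIsExact` (stmt-QuantumAdvantage-14043) — negative side (disprover gen 13):
  the PROJECTION CONCATENATION (`2^k`-fold Maiorana–McFarland concatenation) and its forrelation calculus

For `h : 𝔽₂^M × 𝔽₂^k → 𝔽₂` (a family of `2^k` functions `h_a = h(·,a)` on `M` bits) the projection
concatenation is `G(y'', y', x) = h(y', y'') ⊕ x·y''` on `k + (M + k)` bits (`pcG h`; the classical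
concatenation of the `h_a` in the Maiorana–McFarland frame, C. Carlet, *Boolean Functions for Cryptography
and Coding Theory* (CUP 2021) §6.1 — `k = 1` is the `4`-concatenation of `…ConcatAveraging` up to an affine
change of the two outer bits). Everything about its forrelation values reduces to the SLICES:
* `pc_W` — the Walsh transform `W_G(b'', b', a) = 2^k (-1)^{a·b''} W_{h_a}(b')`; so `G` is bent iff every `h_a`
  is, with dual `d(b', a) ⊕ a·b''` = `pcF d` where `d(·,a)` is the dual of `h_a` (`pc_W_of_duals`);
* `pc_forrelation_avg` — **the averaging identity** `Φ(pcF C, pcG h) = 2^{-k} Σ_a Φ(C_a, h_a)` for ALL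
  Boolean `C, h` (the value set of cubic Forrelation is closed under `2^k`-fold averages of "jointly cubic"
  families: `pcF C`, `pcG h` are cubic as soon as `(u,a) ↦ C(u,a)`, `(y,a) ↦ h(y,a)` are, `pcG_isDegLeFun`);
* `pc_card_ge` / `pc_forrelation_le` — **the master bound**: if the `h_a` are bent (`M = m + m`, duals `d_a`)
  and the DUAL TABLE `Ψ(b', a) = d_a(b')` on `M + k` bits is at Hamming distance `≥ L` from every cubic, then
  EVERY cubic `f` has `#{f ≠ dual of G} ≥ 2^k L`, i.e. `Φ(f, G) ≤ 1 − L/2^{M+k−1}` (each `b''`-slice of a cubic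
  is cubic and `a·b''` is linear in `a` for fixed `b''`). With `pc_forrelation_avg` (take `C_a` = a nearest
  cubic to `Ψ(·,·)` jointly) the bound is attained: `Φ_max(G) = 1 − dist(Ψ, RM(3, M+k))/2^{M+k−1}`.
Consequences used in the disproof programme (DISPROOF.md §20, HOME `run/shared/lean/b2b/cubic-forrelation/`):
`Φ_max(G) = 31/32 ⟺ dist(Ψ, RM(3,M+k)) = 2^{M+k−6}`; LEMMA H (a RED pair, `k = 1`, defect a codim-`c₀` flat
⇒ `1 − 2^{−c₀}` at `M + 2`), the `t`-cube ladder (`k = t`), and the `n₀`-reduction of projection families all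
follow by evaluating `dist(Ψ, RM(3))`. HONEST FRAMING: an instrument (identity + bound), not summit progress.
Proved from the tree (`sum_append`, `twist_append`, `sum_twist_left`, `twist_bxor_right`, `fsum_signOf_eq`,
`cd_forrelation_eq_of_dual`, `acx_deg_slice`, `fc_isDegLeFun_comp`, `fc_deg_bxor`); standard axioms. [folklore]
-/

set_option linter.dupNamespace false -- D-0017: single-problem summit ⇒ `QuantumAdvantage.QuantumAdvantage` by design

noncomputable section

namespace Summit.QuantumAdvantage.QuantumAdvantage.Theorems.NearExactIsExact.Negative.ProjectionConcat

open Finset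
open Literature.Computability.QuantumComplexity
open Literature.Computability.QuantumComplexity.BuzetChailloux (bxor zeroVec phi_signOf bxor_self bxor_eq_zeroVec_iff
  twist_bxor_right sum_twist_left)
open Literature.Computability.QuantumComplexity.DerivativeWalsh (W fsum phi_eq_fsum fsum_eq_sum_mul_W fsum_signOf_eq)
open Literature.Computability.QuantumComplexity.Simon (twist_mul_self twist_eq_neg_one_pow)
open Summit.QuantumAdvantage.QuantumAdvantage.Theorems.CubicForrelation.NearExactIsExact
  (acx_deg_slice acx_deg_mono fc_deg_bxor fc_isDegLeFun_comp rm_isDegLeFun_congr)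
open Summit.QuantumAdvantage.QuantumAdvantage.Theorems.NearExactIsExact.Negative.ConcatDefect
  (cd_forrelation_eq_of_dual)

variable {M k : ℕ}

/-! ### Blocks of `z ∈ 𝔽₂^{k + (M + k)}`: `z = (fst z ‖ mid z ‖ lst z)` -/

/-- The first block (`k` bits: `y''` on the `G` side, `b''` on the `F` side). -/
def fst (z : Fin (k + (M + k)) → Bool) : Fin k → Bool := fun j => z (Fin.castAdd (M + k) j)

/-- The middle block (`M` bits: `y'` / `b'`). -/
def mid (z : Fin (k + (M + k)) → Bool) : Fin M → Bool := fun i => z (Fin.natAdd k (Fin.castAdd k i))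

/-- The last block (`k` bits: `x` / `a`). -/
def lst (z : Fin (k + (M + k)) → Bool) : Fin k → Bool := fun j => z (Fin.natAdd k (Fin.natAdd M j))

/-- `fst (c ‖ v) = c`. -/
@[simp] theorem fst_append (c : Fin k → Bool) (v : Fin (M + k) → Bool) :
    fst (Fin.append c v) = c := by
  funext j; simp [fst]

/-- `mid (c ‖ v)` = the first `M` bits of `v`. -/
@[simp] theorem mid_append (c : Fin k → Bool) (v : Fin (M + k) → Bool) :
    mid (Fin.append c v) = fun i => v (Fin.castAdd k i) := by
  funext i; simp [mid]

/-- `lst (c ‖ v)` = the last `k` bits of `v`. -/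
@[simp] theorem lst_append (c : Fin k → Bool) (v : Fin (M + k) → Bool) :
    lst (Fin.append c v) = fun j => v (Fin.natAdd M j) := by
  funext j; simp [lst]

/-- `mid (c ‖ u ‖ a) = u`. -/
theorem mid_append₂ (c a : Fin k → Bool) (u : Fin M → Bool) :
    mid (Fin.append c (Fin.append u a)) = u := by
  funext i; simp [mid]

/-- `lst (c ‖ u ‖ a) = a`. -/
theorem lst_append₂ (c a : Fin k → Bool) (u : Fin M → Bool) :
    lst (Fin.append c (Fin.append u a)) = a := by
  funext j; simp [lst]

/-- `z = (fst z ‖ mid z ‖ lst z)`. -/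
theorem append_fst_mid_lst (z : Fin (k + (M + k)) → Bool) :
    Fin.append (fst z) (Fin.append (mid z) (lst z)) = z := by
  have h1 : Fin.append (mid z) (lst z) = fun i => z (Fin.natAdd k i) :=
    Fin.append_castAdd_natAdd (f := fun i => z (Fin.natAdd k i))
  rw [h1]
  exact Fin.append_castAdd_natAdd (f := z)

/-! ### The inner product bit `a·b` -/

/-- The inner product `a·b ∈ 𝔽₂` of two `k`-bit vectors, as a Boolean. -/
def ipb (a b : Fin k → Bool) : Bool := decide (Odd (univ.filter fun i => a i && b i).card)

/-- `(-1)^{[a·b]} = (-1)^{a·b}`: the sign of `ipb` is the character `twist`. -/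
theorem signOf_ipb (a b : Fin k → Bool) : signOf (ipb a b) = twist a b := by
  rw [twist_eq_neg_one_pow]
  unfold ipb
  rcases Nat.even_or_odd (univ.filter fun i => a i && b i).card with h | h
  · rw [h.neg_one_pow, decide_eq_false (Nat.not_odd_iff_even.mpr h)]
    simp [signOf]
  · rw [h.neg_one_pow, decide_eq_true h]
    simp [signOf]

/-- `a ↦ a·b` is linear (degree `≤ 1`). -/
theorem ipb_isDegLeFun_left (b : Fin k → Bool) : IsDegLeFun 1 (fun a : Fin k → Bool => ipb a b) := by
  classical
  refine ⟨∑ i ∈ univ.filter (fun i => b i = true), MvPolynomial.X i, ?_, fun a => ?_⟩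
  · refine (MvPolynomial.totalDegree_finsetSum _ _).trans (Finset.sup_le fun i _ => ?_)
    exact (MvPolynomial.totalDegree_X (R := ZMod 2) i).le
  · rw [polyPhase_apply, map_sum]
    simp only [MvPolynomial.eval_X]
    rw [Finset.sum_boole, Finset.filter_filter]
    unfold ipb
    rw [decide_eq_decide, ZMod.natCast_eq_one_iff_odd]
    have e : (univ.filter fun i => b i = true ∧ a i = true) = univ.filter fun i => a i && b i :=
      filter_congr fun i _ => by cases a i <;> cases b i <;> simp
    rw [e]

/-- `(z) ↦ (lst z)·(fst z)` has degree `≤ 2`. -/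
theorem ipb_isDegLeFun_two : IsDegLeFun 2 (fun z : Fin (k + (M + k)) → Bool => ipb (lst z) (fst z)) := by
  classical
  refine ⟨∑ i : Fin k, MvPolynomial.X (Fin.natAdd k (Fin.natAdd M i)) * MvPolynomial.X (Fin.castAdd (M + k) i),
    ?_, fun z => ?_⟩
  · refine (MvPolynomial.totalDegree_finsetSum _ _).trans (Finset.sup_le fun i _ => ?_)
    refine (MvPolynomial.totalDegree_mul _ _).trans ?_
    rw [MvPolynomial.totalDegree_X, MvPolynomial.totalDegree_X]
  · rw [polyPhase_apply, map_sum]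
    simp only [map_mul, MvPolynomial.eval_X]
    have e1 : ∀ i : Fin k, ((if z (Fin.natAdd k (Fin.natAdd M i)) = true then (1 : ZMod 2) else 0) *
        (if z (Fin.castAdd (M + k) i) = true then (1 : ZMod 2) else 0)) =
        (if (z (Fin.natAdd k (Fin.natAdd M i)) && z (Fin.castAdd (M + k) i)) = true then (1 : ZMod 2) else 0) := by
      intro i
      cases z (Fin.natAdd k (Fin.natAdd M i)) <;> cases z (Fin.castAdd (M + k) i) <;> simp
    simp_rw [e1]
    rw [Finset.sum_boole]
    unfold ipb lst fst
    rw [decide_eq_decide, ZMod.natCast_eq_one_iff_odd]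

/-! ### The projection concatenation and its `F`-side pattern -/

/-- `G(y'', y', x) = h(y', y'') ⊕ x·y''`: the concatenation of the family `h_a = h(·, a)`, `a ∈ 𝔽₂^k`, in the
Maiorana–McFarland frame (`x, y'' ∈ 𝔽₂^k`, `y' ∈ 𝔽₂^M`; blocks ordered `y'' ‖ y' ‖ x`). -/
def pcG (h : (Fin M → Bool) → (Fin k → Bool) → Bool) (w : Fin (k + (M + k)) → Bool) : Bool :=
  xor (h (mid w) (fst w)) (ipb (lst w) (fst w))

/-- `F(b'', b', a) = C(b', a) ⊕ a·b''`: the matching pattern on the dual side (the dual of a bent `pcG h` is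
`pcF d` with `d(·,a)` the dual of `h(·,a)`, `pc_W_of_duals`). -/
def pcF (C : (Fin M → Bool) → (Fin k → Bool) → Bool) (z : Fin (k + (M + k)) → Bool) : Bool :=
  xor (C (mid z) (lst z)) (ipb (lst z) (fst z))

/-- `pcG h` is cubic when `(y' ‖ a) ↦ h(y', a)` is (jointly) cubic. -/
theorem pcG_isDegLeFun (h : (Fin M → Bool) → (Fin k → Bool) → Bool)
    (hh : IsDegLeFun 3 (fun v : Fin (M + k) → Bool => h (fun i => v (Fin.castAdd k i)) (fun j => v (Fin.natAdd M j)))) :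
    IsDegLeFun 3 (pcG h) := by
  have h1 : IsDegLeFun 3 (fun w : Fin (k + (M + k)) → Bool => h (mid w) (fst w)) :=
    rm_isDegLeFun_congr (fc_isDegLeFun_comp hh (fun w : Fin (k + (M + k)) → Bool => Fin.append (mid w) (fst w))
      (fun v => by
        induction v using Fin.addCases with
        | left i => simp only [Fin.append_left]; exact isDegLeFun_apply _ le_rfl
        | right j => simp only [Fin.append_right]; exact isDegLeFun_apply _ le_rfl) (le_refl (1 * 3)))
      (fun w => by simp only [Fin.append_left, Fin.append_right])
  exact fc_deg_bxor h1 (acx_deg_mono (by norm_num) ipb_isDegLeFun_two)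

/-- `pcF C` is cubic when `(b' ‖ a) ↦ C(b', a)` is (jointly) cubic. -/
theorem pcF_isDegLeFun (C : (Fin M → Bool) → (Fin k → Bool) → Bool)
    (hC : IsDegLeFun 3 (fun v : Fin (M + k) → Bool => C (fun i => v (Fin.castAdd k i)) (fun j => v (Fin.natAdd M j)))) :
    IsDegLeFun 3 (pcF C) := by
  have h1 : IsDegLeFun 3 (fun z : Fin (k + (M + k)) → Bool => C (mid z) (lst z)) :=
    rm_isDegLeFun_congr (fc_isDegLeFun_comp hC (fun z : Fin (k + (M + k)) → Bool => Fin.append (mid z) (lst z))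
      (fun v => by
        induction v using Fin.addCases with
        | left i => simp only [Fin.append_left]; exact isDegLeFun_apply _ le_rfl
        | right j => simp only [Fin.append_right]; exact isDegLeFun_apply _ le_rfl) (le_refl (1 * 3)))
      (fun z => by simp only [Fin.append_left, Fin.append_right])
  exact fc_deg_bxor h1 (acx_deg_mono (by norm_num) ipb_isDegLeFun_two)

/-! ### The Walsh transform of the projection concatenation -/

/-- `Σ_x (-1)^{x·y''} (-1)^{x·a} = 2^k [y'' = a]`. -/
theorem sum_twist_twist (y a : Fin k → Bool) :
    ∑ x : Fin k → Bool, twist x y * twist x a = if y = a then (2 : ℝ) ^ k else 0 := by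
  have e : ∑ x : Fin k → Bool, twist x y * twist x a = ∑ x : Fin k → Bool, twist x (bxor y a) :=
    sum_congr rfl fun x _ => by rw [twist_bxor_right]
  rw [e, sum_twist_left]
  by_cases hy : y = a
  · rw [if_pos hy, if_pos ((bxor_eq_zeroVec_iff y a).2 hy)]
  · rw [if_neg hy, if_neg (mt (bxor_eq_zeroVec_iff y a).1 hy)]

/-- **Walsh transform of `pcG h`** on block arguments:
`W_G(c ‖ u ‖ a) = 2^k (-1)^{a·c} W_{h_a}(u)`. -/
theorem pc_W_append (h : (Fin M → Bool) → (Fin k → Bool) → Bool) (c a : Fin k → Bool) (u : Fin M → Bool) :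
    W (fun w => signOf (pcG h w)) (Fin.append c (Fin.append u a)) =
      (2 : ℝ) ^ k * twist a c * W (fun y => signOf (h y a)) u := by
  unfold W
  rw [sum_append]
  simp_rw [sum_append (n₁ := M) (n₂ := k)]
  simp only [pcG, fst_append, mid_append₂, lst_append₂, twist_append, signOf_xor, signOf_ipb]
  have inner : ∀ (y'' : Fin k → Bool) (y : Fin M → Bool),
      ∑ x : Fin k → Bool, signOf (h y y'') * twist x y'' * (twist y'' c * (twist y u * twist x a)) =
        (signOf (h y y'') * twist y'' c * twist y u) * (if y'' = a then (2 : ℝ) ^ k else 0) := by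
    intro y'' y
    rw [← sum_twist_twist y'' a, mul_sum]
    exact sum_congr rfl fun x _ => by ring
  simp_rw [inner]
  have e2 : ∀ y'' : Fin k → Bool,
      ∑ y : Fin M → Bool, signOf (h y y'') * twist y'' c * twist y u * (if y'' = a then (2 : ℝ) ^ k else 0) =
        if y'' = a then (2 : ℝ) ^ k * twist a c * ∑ y : Fin M → Bool, signOf (h y a) * twist y u else 0 := by
    intro y''
    by_cases hy : y'' = a
    · subst hy
      rw [if_pos rfl, if_pos rfl, mul_sum]
      exact sum_congr rfl fun y _ => by ring
    · rw [if_neg hy, if_neg hy]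
      simp
  simp_rw [e2]
  rw [sum_ite_eq' univ a, if_pos (mem_univ _)]

/-- **Walsh transform of `pcG h`**: `W_G(z) = 2^k (-1)^{lst z · fst z} W_{h_{lst z}}(mid z)`. -/
theorem pc_W (h : (Fin M → Bool) → (Fin k → Bool) → Bool) (z : Fin (k + (M + k)) → Bool) :
    W (fun w => signOf (pcG h w)) z = (2 : ℝ) ^ k * twist (lst z) (fst z) * W (fun y => signOf (h y (lst z))) (mid z) := by
  have e := pc_W_append h (fst z) (lst z) (mid z)
  rwa [append_fst_mid_lst] at e

/-- **Bentness and dual.** If every slice `h_a` has `W_{h_a} = K·(-1)^{d_a}` then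
`W_{pcG h} = 2^k K · (-1)^{pcF d}`: `pcG h` is bent iff the slices are, with dual `d(b',a) ⊕ a·b''`. -/
theorem pc_W_of_duals (h d : (Fin M → Bool) → (Fin k → Bool) → Bool) (K : ℝ)
    (hK : ∀ a u, W (fun y => signOf (h y a)) u = K * signOf (d u a)) (z : Fin (k + (M + k)) → Bool) :
    W (fun w => signOf (pcG h w)) z = ((2 : ℝ) ^ k * K) * signOf (pcF d z) := by
  rw [pc_W, hK]
  simp only [pcF, signOf_xor, signOf_ipb]
  ring

/-! ### The averaging identity -/

/-- **`Φ(pcF C, pcG h) = 2^{-k} Σ_a Φ(C_a, h_a)`** for all Boolean `C, h`. -/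
theorem pc_forrelation_avg (C h : (Fin M → Bool) → (Fin k → Bool) → Bool) :
    forrelation (pcF C) (pcG h) =
      (∑ a : Fin k → Bool, forrelation (fun u => C u a) (fun y => h y a)) / 2 ^ k := by
  rw [← phi_signOf, phi_eq_fsum, fsum_eq_sum_mul_W]
  simp_rw [pc_W h]
  rw [sum_append]
  simp_rw [sum_append (n₁ := M) (n₂ := k)]
  simp only [pcF, fst_append, mid_append₂, lst_append₂, signOf_xor, signOf_ipb]
  have e1 : ∀ (c a : Fin k → Bool) (u : Fin M → Bool),
      signOf (C u a) * twist a c * ((2 : ℝ) ^ k * twist a c * W (fun y => signOf (h y a)) u) =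
        (2 : ℝ) ^ k * (signOf (C u a) * W (fun y => signOf (h y a)) u) := by
    intro c a u
    have hsq := twist_mul_self a c
    linear_combination ((2 : ℝ) ^ k * signOf (C u a) * W (fun y => signOf (h y a)) u) * hsq
  simp_rw [e1]
  rw [sum_const, card_univ, Fintype.card_fun, Fintype.card_bool, Fintype.card_fin, sum_comm]
  have e2 : ∀ a : Fin k → Bool,
      ∑ u : Fin M → Bool, (2 : ℝ) ^ k * (signOf (C u a) * W (fun y => signOf (h y a)) u) =
        (2 : ℝ) ^ k * (Real.sqrt (2 ^ (3 * M)) * forrelation (fun u => C u a) (fun y => h y a)) := by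
    intro a
    rw [← mul_sum, ← fsum_eq_sum_mul_W, fsum_signOf_eq]
  simp_rw [e2]
  rw [← mul_sum, ← mul_sum, nsmul_eq_mul, sqrt_two_pow_three_mul_add, sqrt_two_pow_three_mul_add,
    DerivativeWalsh.sqrt_two_pow_three_mul k]
  push_cast
  have hs : Real.sqrt ((2 : ℝ) ^ k) * Real.sqrt ((2 : ℝ) ^ k) = (2 : ℝ) ^ k := Real.mul_self_sqrt (by positivity)
  have hM : (0 : ℝ) < Real.sqrt (2 ^ (3 * M)) := by positivity
  have hk : (0 : ℝ) < (2 : ℝ) ^ k := by positivity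
  have hsk : (0 : ℝ) < Real.sqrt ((2 : ℝ) ^ k) := by positivity
  rw [inv_mul_eq_div, div_eq_div_iff (by positivity) (by positivity)]
  linear_combination (-((2 : ℝ) ^ k * (2 : ℝ) ^ k * Real.sqrt (2 ^ (3 * M)) *
    ∑ a : Fin k → Bool, forrelation (fun u => C u a) (fun y => h y a))) * hs

/-- **Halving next to exact slices** (the case used by ladders): if `Φ(C_a, h_a) = 1` for all `a ≠ a₀` then
`Φ(pcF C, pcG h) = 1 − (1 − Φ(C_{a₀}, h_{a₀}))/2^k`. -/
theorem pc_forrelation_avg_of_exact (C h : (Fin M → Bool) → (Fin k → Bool) → Bool) (a₀ : Fin k → Bool)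
    (hex : ∀ a, a ≠ a₀ → forrelation (fun u => C u a) (fun y => h y a) = 1) :
    forrelation (pcF C) (pcG h) = 1 - (1 - forrelation (fun u => C u a₀) (fun y => h y a₀)) / 2 ^ k := by
  rw [pc_forrelation_avg]
  have e : ∑ a : Fin k → Bool, forrelation (fun u => C u a) (fun y => h y a) =
      ∑ a : Fin k → Bool, ((if a = a₀ then forrelation (fun u => C u a₀) (fun y => h y a₀) - 1 else 0) + 1) := by
    refine sum_congr rfl fun a _ => ?_
    by_cases ha : a = a₀
    · subst ha; simp
    · rw [if_neg ha, hex a ha]; ring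
  rw [e, sum_add_distrib, sum_ite_eq' univ a₀, if_pos (mem_univ _), sum_const, card_univ, Fintype.card_fun,
    Fintype.card_bool, Fintype.card_fin, nsmul_eq_mul]
  push_cast
  have hk : (0 : ℝ) < (2 : ℝ) ^ k := by positivity
  field_simp
  ring

/-! ### The master bound: the defect of `pcG h` is at least `2^k` times the cubic distance of the dual table -/

/-- Counting along the first block: `#{z : P z} = Σ_c #{v : P (c ‖ v)}`. -/
theorem card_filter_append {n₁ n₂ : ℕ} (P : (Fin (n₁ + n₂) → Bool) → Prop) [DecidablePred P] :
    (univ.filter P).card = ∑ c : Fin n₁ → Bool, (univ.filter fun v : Fin n₂ → Bool => P (Fin.append c v)).card := by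
  simp only [card_filter]
  rw [← (Fin.appendEquiv n₁ n₂).sum_comp, Fintype.sum_prod_type]
  rfl

/-- `v ↦ (last k bits of v)·c` is linear on `𝔽₂^{M+k}`. -/
theorem ipb_suffix_isDegLeFun (c : Fin k → Bool) :
    IsDegLeFun 1 (fun v : Fin (M + k) → Bool => ipb (fun j => v (Fin.natAdd M j)) c) :=
  fc_isDegLeFun_comp (ipb_isDegLeFun_left c) (fun v : Fin (M + k) → Bool => fun j => v (Fin.natAdd M j))
    (fun j => isDegLeFun_apply (Fin.natAdd M j) le_rfl) (le_refl (1 * 1))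

/-- **Slicing lemma.** If the dual table `(b' ‖ a) ↦ d(b', a)` is at distance `≥ L` from every cubic on
`M + k` bits, then every cubic `f` on `k + (M + k)` bits misses the pattern `pcF d` in at least `2^k · L`
points (slice along `b''`; `f(b'' ‖ ·) ⊕ (·)·b''` is cubic). -/
theorem pc_card_ge (f : (Fin (k + (M + k)) → Bool) → Bool) (hf : IsDegLeFun 3 f)
    (d : (Fin M → Bool) → (Fin k → Bool) → Bool) (L : ℕ)
    (hL : ∀ c' : (Fin (M + k) → Bool) → Bool, IsDegLeFun 3 c' →
      L ≤ (univ.filter fun v => c' v ≠ d (fun i => v (Fin.castAdd k i)) (fun j => v (Fin.natAdd M j))).card) :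
    2 ^ k * L ≤ (univ.filter fun z => f z ≠ pcF d z).card := by
  rw [card_filter_append]
  have key : ∀ c : Fin k → Bool,
      L ≤ (univ.filter fun v : Fin (M + k) → Bool => f (Fin.append c v) ≠ pcF d (Fin.append c v)).card := by
    intro c
    have hc' : IsDegLeFun 3 (fun v : Fin (M + k) → Bool => f (Fin.append c v) ^^ ipb (fun j => v (Fin.natAdd M j)) c) :=
      fc_deg_bxor (acx_deg_slice hf c) (acx_deg_mono (by norm_num) (ipb_suffix_isDegLeFun c))
    refine (hL _ hc').trans (le_of_eq (congrArg card (filter_congr fun v _ => ?_)))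
    simp only [pcF, fst_append, mid_append, lst_append]
    cases f (Fin.append c v) <;> cases ipb (fun j => v (Fin.natAdd M j)) c <;>
      cases d (fun i => v (Fin.castAdd k i)) (fun j => v (Fin.natAdd M j)) <;> decide
  calc 2 ^ k * L = ∑ _c : Fin k → Bool, L := by
        rw [sum_const, card_univ, Fintype.card_fun, Fintype.card_bool, Fintype.card_fin, smul_eq_mul]
    _ ≤ _ := sum_le_sum fun c _ => key c

/-- `√(2^{k + (m + m + k)}) = 2^k · 2^m`. -/
theorem pc_sqrt (m k : ℕ) : Real.sqrt ((2 : ℝ) ^ (k + (m + m + k))) = (2 : ℝ) ^ k * (2 : ℝ) ^ m := by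
  rw [show (2 : ℝ) ^ (k + (m + m + k)) = ((2 : ℝ) ^ k * (2 : ℝ) ^ m) ^ 2 by ring, Real.sqrt_sq (by positivity)]

/-- **The duality formula for `pcG h`.** With bent slices (`W_{h_a} = 2^m (-1)^{d_a}` on `m + m` bits),
`Φ(f, pcG h) = 1 − 2·#{f ≠ pcF d}/2^{k + (m + m + k)}` for every `f`. -/
theorem pc_forrelation_eq {m k : ℕ} (h d : (Fin (m + m) → Bool) → (Fin k → Bool) → Bool)
    (hd : ∀ a u, W (fun y => signOf (h y a)) u = (2 : ℝ) ^ m * signOf (d u a))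
    (f : (Fin (k + (m + m + k)) → Bool) → Bool) :
    forrelation f (pcG h) =
      1 - 2 * ((univ.filter fun z => f z ≠ pcF d z).card : ℝ) / 2 ^ (k + (m + m + k)) := by
  refine cd_forrelation_eq_of_dual f (pcG h) (pcF d) fun z => ?_
  rw [pc_W_of_duals h d ((2 : ℝ) ^ m) hd z, pc_sqrt]

/-- **MASTER BOUND.** Let the slices `h_a` (`a ∈ 𝔽₂^k`) be bent on `m + m` bits with duals `d_a`, and let the
dual table `(b' ‖ a) ↦ d_a(b')` be at Hamming distance `≥ L` from every cubic on `m + m + k` bits. Then every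
cubic `f` has `Φ(f, pcG h) ≤ 1 − 2·2^k L/2^{k+(m+m+k)} = 1 − L/2^{m+m+k−1}`. (So `Φ > 1 − 2^{-j}` against some
cubic forces `dist(Ψ, RM(3, m+m+k)) < 2^{m+m+k−1−j}`; `31/32` needs a flat of bent slices whose dual table is
within `2^{m+m+k−6}` of a cubic but is not cubic.) -/
theorem pc_forrelation_le {m k : ℕ} (h d : (Fin (m + m) → Bool) → (Fin k → Bool) → Bool)
    (hd : ∀ a u, W (fun y => signOf (h y a)) u = (2 : ℝ) ^ m * signOf (d u a))
    (L : ℕ) (hL : ∀ c' : (Fin (m + m + k) → Bool) → Bool, IsDegLeFun 3 c' →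
      L ≤ (univ.filter fun v => c' v ≠ d (fun i => v (Fin.castAdd k i)) (fun j => v (Fin.natAdd (m + m) j))).card)
    (f : (Fin (k + (m + m + k)) → Bool) → Bool) (hf : IsDegLeFun 3 f) :
    forrelation f (pcG h) ≤ 1 - 2 * ((2 : ℝ) ^ k * L) / 2 ^ (k + (m + m + k)) := by
  rw [pc_forrelation_eq h d hd f]
  have hc : ((2 : ℝ) ^ k * L : ℝ) ≤ ((univ.filter fun z => f z ≠ pcF d z).card : ℝ) := by
    exact_mod_cast pc_card_ge f hf d L hL
  have hpos : (0 : ℝ) < 2 ^ (k + (m + m + k)) := by positivity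
  have h2 := div_le_div_of_nonneg_right (mul_le_mul_of_nonneg_left hc (by norm_num : (0 : ℝ) ≤ 2)) hpos.le
  linarith

/-- **No exact partner unless the dual table is cubic.** If the slices are bent with duals `d_a` and the dual
table is NOT cubic on `m + m + k` bits, then `Φ(f, pcG h) ≠ 1` for every cubic `f`. -/
theorem pc_no_exact_partner {m k : ℕ} (h d : (Fin (m + m) → Bool) → (Fin k → Bool) → Bool)
    (hd : ∀ a u, W (fun y => signOf (h y a)) u = (2 : ℝ) ^ m * signOf (d u a))
    (hΨ : ¬ IsDegLeFun 3 (fun v : Fin (m + m + k) → Bool =>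
      d (fun i => v (Fin.castAdd k i)) (fun j => v (Fin.natAdd (m + m) j))))
    (f : (Fin (k + (m + m + k)) → Bool) → Bool) (hf : IsDegLeFun 3 f) :
    forrelation f (pcG h) ≠ 1 := by
  have hL : ∀ c' : (Fin (m + m + k) → Bool) → Bool, IsDegLeFun 3 c' →
      1 ≤ (univ.filter fun v => c' v ≠ d (fun i => v (Fin.castAdd k i)) (fun j => v (Fin.natAdd (m + m) j))).card := by
    intro c' hc'
    rw [Nat.one_le_iff_ne_zero, Ne, card_eq_zero, filter_eq_empty_iff]
    intro hall
    apply hΨ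
    have e : c' = fun v => d (fun i => v (Fin.castAdd k i)) (fun j => v (Fin.natAdd (m + m) j)) :=
      funext fun v => by simpa using hall (mem_univ v)
    rwa [e] at hc'
  have hb := pc_forrelation_le h d hd 1 hL f hf
  have hpos : (0 : ℝ) < 2 * ((2 : ℝ) ^ k * ((1 : ℕ) : ℝ)) / 2 ^ (k + (m + m + k)) := by positivity
  intro heq
  rw [heq] at hb
  linarith

end Summit.QuantumAdvantage.QuantumAdvantage.Theorems.NearExactIsExact.Negative.ProjectionConcat

end
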